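import Mathlib
import Summits.KontsevichZagierPeriods.KontsevichZagierPeriods.Theorems.InverseLandauTateLiftingPullback
import Summits.KontsevichZagierPeriods.KontsevichZagierPeriods.Theorems.InverseLandauTateLiftingRotationEngineAux
import Literature.NumberTheory.Transcendental.KZDominatedFamilyRelations
import Literature.NumberTheory.Transcendental.KZLogCalculusProofs
import Literature.NumberTheory.Transcendental.SemialgebraicMapsProofs
import Summits.KontsevichZagierPeriods.KontsevichZagierPeriods.Theorems.K2SymbolChainsFigureEightIsTwoSmythAlgebra

/-!
# `TateLifting` (stmt-KontsevichZagierPeriods-9129), line `Sketch` — stub 44: THE ROTATION ENGINE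

Let `r = [σ, f]` be an integral representation of dimension `n + 2` whose domain and integrand are
invariant under the rotations of the last two coordinates `(y, z) = (x_n, x_{n+1})`. Then the honest
REDUCED representation

  `q = [{(v, ρ, u) | ρ > 0, (v, ρ, 0) ∈ σ}, 2ρ/(1+u²) · f(v, ρ, 0)]`

exists and `[σ, f] − [q] ∈ KZ.relations` (`tateLifting_rotationEngine`). Inside the Kontsevich–Zagier
rules this is

* rule (1a): excise the half-hyperplane `N = {z = 0, y ≤ 0}`, a null set
  (`KZ.IntegralRep.of_sub_of_restrict_mem_relations`);
* rule (2): ONE change of variables along the TAN-HALF-ANGLE CHART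
  `Φ(v, ρ, u) = (v, ρ(1−u²)/(1+u²), 2ρu/(1+u²))` (`RotationEngine.exists_rotationChart`) from
  `D = {ρ > 0, (v, ρ, 0) ∈ σ}` onto `σ ∖ N`: `Φ` is a rational map (hence `ℚ`-semialgebraic), injective on
  `ρ > 0` (`u` is recovered as `z/(ρ + y)`), everywhere differentiable with `|det Φ′| = 2ρ/(1+u²)`; by
  invariance `f(Φ(v, ρ, u)) = f(v, ρ, 0)` on `D`, which gives the integrand of `q` literally; honesty of `q`
  (semialgebraic integrand, absolute integrability) is transported along the chart (`tateLifting_pullback`).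

This is the general form (any dimension, spectator coordinates untouched) of the "plane engine"
`IsotropyFactorisation2` of route HardSphereVirial (`tateLifting_isotropyPlane`).

References: M. Kontsevich, D. Zagier, *Periods* (2001), §1.2 rules (1), (2); J. Bochnak, M. Coste, M.-F. Roy,
*Real Algebraic Geometry* (1998), §2.1–2.2 (semialgebraic sets and maps); the rest is folklore calculus.
-/

noncomputable section

open MeasureTheory Set
open Literature.NumberTheory.Transcendental
open Literature.ModelTheory.ExponentialFields (IsSemialgebraic)
open Summit.KontsevichZagierPeriods.KontsevichZagierPeriods.Theorems (ratCircle_sq_add_sq)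

namespace Summit.KontsevichZagierPeriods.InverseLandau

namespace RotationEngine

variable {n : ℕ}

/-! ## Domains: the reduced domain `D` and the excised target `E = σ ∖ N` -/

/-- The axis map `w ↦ (v, ρ, 0)` is the tuple of polynomials `X₀, …, X_n, 0`. [cite: BCR1998, §2.1] -/
theorem axis_eq_aeval (w : Fin (n + 2) → ℝ) :
    (fun j => MvPolynomial.aeval w
      ((Fin.lastCases 0 (fun j' => MvPolynomial.X (Fin.castSucc j')) j) : MvPolynomial (Fin (n + 2)) ℚ)) =
      (Fin.snoc (Fin.init w : Fin (n + 1) → ℝ) 0 : Fin (n + 2) → ℝ) := by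
  ext j
  refine Fin.lastCases ?_ (fun j' => ?_) j
  · simp
  · simp [Fin.init]

/-- The reduced domain `D = {ρ > 0, (v, ρ, 0) ∈ σ}` is `ℚ`-semialgebraic (preimage of `σ` under a
polynomial map). [cite: BCR1998, §2.1] -/
theorem isSemialgebraic_reducedDomain {σ : Set (Fin (n + 2) → ℝ)} (hσ : IsSemialgebraic ℚ σ) :
    IsSemialgebraic ℚ {w : Fin (n + 2) → ℝ | 0 < (Fin.init w : Fin (n + 1) → ℝ) (Fin.last n) ∧
      (Fin.snoc (Fin.init w : Fin (n + 1) → ℝ) 0 : Fin (n + 2) → ℝ) ∈ σ} := by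
  have h1 : IsSemialgebraic ℚ {w : Fin (n + 2) → ℝ | 0 < (Fin.init w : Fin (n + 1) → ℝ) (Fin.last n)} := by
    convert Literature.ModelTheory.ExponentialFields.isSemialgebraic_setOf_eval_pos (k := ℚ) (R := ℝ)
      (MvPolynomial.X (Fin.castSucc (Fin.last n)) : MvPolynomial (Fin (n + 2)) ℚ) using 1
    ext w
    simp [Fin.init]
  have h2 := hσ.preimage_aeval
    (fun j => (Fin.lastCases 0 (fun j' => MvPolynomial.X (Fin.castSucc j')) j : MvPolynomial (Fin (n + 2)) ℚ))
  have h2' : IsSemialgebraic ℚ {w : Fin (n + 2) → ℝ |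
      (Fin.snoc (Fin.init w : Fin (n + 1) → ℝ) 0 : Fin (n + 2) → ℝ) ∈ σ} := by
    convert h2 using 1
    ext w
    simp only [mem_setOf_eq, mem_preimage, axis_eq_aeval]
  exact h1.inter h2'

/-- The excised target `E = {x ∈ σ | z ≠ 0 ∨ y > 0}` is `ℚ`-semialgebraic. [cite: BCR1998, §2.1] -/
theorem isSemialgebraic_excised {σ : Set (Fin (n + 2) → ℝ)} (hσ : IsSemialgebraic ℚ σ) :
    IsSemialgebraic ℚ {x ∈ σ | x (Fin.last (n + 1)) ≠ 0 ∨ 0 < (Fin.init x : Fin (n + 1) → ℝ) (Fin.last n)} := by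
  have h1 : IsSemialgebraic ℚ {x : Fin (n + 2) → ℝ | x (Fin.last (n + 1)) = 0} := by
    convert Literature.ModelTheory.ExponentialFields.isSemialgebraic_setOf_eval_eq_zero (k := ℚ) (R := ℝ)
      (MvPolynomial.X (Fin.last (n + 1)) : MvPolynomial (Fin (n + 2)) ℚ) using 1
    ext x
    simp
  have h2 : IsSemialgebraic ℚ {x : Fin (n + 2) → ℝ | 0 < (Fin.init x : Fin (n + 1) → ℝ) (Fin.last n)} := by
    convert Literature.ModelTheory.ExponentialFields.isSemialgebraic_setOf_eval_pos (k := ℚ) (R := ℝ)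
      (MvPolynomial.X (Fin.castSucc (Fin.last n)) : MvPolynomial (Fin (n + 2)) ℚ) using 1
    ext x
    simp [Fin.init]
  convert hσ.inter (h1.compl.union h2) using 1
  ext x
  simp only [mem_setOf_eq, mem_inter_iff, mem_union, mem_compl_iff]

/-- `σ ∖ E ⊆ {z = 0}` is null. [folklore] -/
theorem volume_diff_excised (σ : Set (Fin (n + 2) → ℝ)) :
    volume (σ \ {x ∈ σ | x (Fin.last (n + 1)) ≠ 0 ∨ 0 < (Fin.init x : Fin (n + 1) → ℝ) (Fin.last n)}) = 0 := by
  refine measure_mono_null (fun x hx => ?_) (KZ.volume_setOf_last_eq_zero (n := n + 1) 0)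
  obtain ⟨hxσ, hxE⟩ := hx
  simp only [mem_setOf_eq, not_and, not_or, not_lt] at hxE
  by_contra hz
  exact (hxE hxσ).1 hz

/-! ## The chart on the reduced domain: into `σ`, onto `E`, injective, semialgebraic -/

section Chart

variable {σ : Set (Fin (n + 2) → ℝ)} {f : (Fin (n + 2) → ℝ) → ℝ} {Φ : (Fin (n + 2) → ℝ) → (Fin (n + 2) → ℝ)}

/-- The chart maps the reduced domain into `σ`, and `f ∘ Φ = f(axis point)` there (invariance applied to
the axis point with `(c, s) = (cos u, sin u)`). [folklore] -/
theorem chart_mem_and_eq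
    (hinv : ∀ x ∈ σ, ∀ c s : ℝ, c ^ 2 + s ^ 2 = 1 →
      (Fin.snoc (Fin.snoc (Fin.init (Fin.init x : Fin (n + 1) → ℝ) : Fin n → ℝ)
          (c * (Fin.init x : Fin (n + 1) → ℝ) (Fin.last n) - s * x (Fin.last (n + 1))) :
            Fin (n + 1) → ℝ)
          (s * (Fin.init x : Fin (n + 1) → ℝ) (Fin.last n) + c * x (Fin.last (n + 1))) :
          Fin (n + 2) → ℝ) ∈ σ ∧
      f (Fin.snoc (Fin.snoc (Fin.init (Fin.init x : Fin (n + 1) → ℝ) : Fin n → ℝ)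
          (c * (Fin.init x : Fin (n + 1) → ℝ) (Fin.last n) - s * x (Fin.last (n + 1))) :
            Fin (n + 1) → ℝ)
          (s * (Fin.init x : Fin (n + 1) → ℝ) (Fin.last n) + c * x (Fin.last (n + 1))) :
          Fin (n + 2) → ℝ) = f x)
    (hΦ : ∀ w, Φ w = Fin.snoc (Fin.snoc (Fin.init (Fin.init w : Fin (n + 1) → ℝ) : Fin n → ℝ)
        ((1 - w (Fin.last (n + 1)) ^ 2) / (1 + w (Fin.last (n + 1)) ^ 2) *
          (Fin.init w : Fin (n + 1) → ℝ) (Fin.last n)) : Fin (n + 1) → ℝ)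
        (2 * w (Fin.last (n + 1)) / (1 + w (Fin.last (n + 1)) ^ 2) *
          (Fin.init w : Fin (n + 1) → ℝ) (Fin.last n)))
    {w : Fin (n + 2) → ℝ} (hw : (Fin.snoc (Fin.init w : Fin (n + 1) → ℝ) 0 : Fin (n + 2) → ℝ) ∈ σ) :
    Φ w ∈ σ ∧ f (Φ w) = f (Fin.snoc (Fin.init w : Fin (n + 1) → ℝ) 0 : Fin (n + 2) → ℝ) := by
  have h := hinv _ hw ((1 - w (Fin.last (n + 1)) ^ 2) / (1 + w (Fin.last (n + 1)) ^ 2))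
    (2 * w (Fin.last (n + 1)) / (1 + w (Fin.last (n + 1)) ^ 2)) (ratCircle_sq_add_sq _)
  simp only [Fin.init_snoc, Fin.snoc_last, mul_zero, sub_zero, add_zero] at h
  rw [hΦ]
  exact h

/-- The chart lands in `E`: its image avoids the non-positive axis. [folklore] -/
theorem chart_mem_excised
    (hinv : ∀ x ∈ σ, ∀ c s : ℝ, c ^ 2 + s ^ 2 = 1 →
      (Fin.snoc (Fin.snoc (Fin.init (Fin.init x : Fin (n + 1) → ℝ) : Fin n → ℝ)
          (c * (Fin.init x : Fin (n + 1) → ℝ) (Fin.last n) - s * x (Fin.last (n + 1))) :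
            Fin (n + 1) → ℝ)
          (s * (Fin.init x : Fin (n + 1) → ℝ) (Fin.last n) + c * x (Fin.last (n + 1))) :
          Fin (n + 2) → ℝ) ∈ σ ∧
      f (Fin.snoc (Fin.snoc (Fin.init (Fin.init x : Fin (n + 1) → ℝ) : Fin n → ℝ)
          (c * (Fin.init x : Fin (n + 1) → ℝ) (Fin.last n) - s * x (Fin.last (n + 1))) :
            Fin (n + 1) → ℝ)
          (s * (Fin.init x : Fin (n + 1) → ℝ) (Fin.last n) + c * x (Fin.last (n + 1))) :
          Fin (n + 2) → ℝ) = f x)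
    (hΦ : ∀ w, Φ w = Fin.snoc (Fin.snoc (Fin.init (Fin.init w : Fin (n + 1) → ℝ) : Fin n → ℝ)
        ((1 - w (Fin.last (n + 1)) ^ 2) / (1 + w (Fin.last (n + 1)) ^ 2) *
          (Fin.init w : Fin (n + 1) → ℝ) (Fin.last n)) : Fin (n + 1) → ℝ)
        (2 * w (Fin.last (n + 1)) / (1 + w (Fin.last (n + 1)) ^ 2) *
          (Fin.init w : Fin (n + 1) → ℝ) (Fin.last n)))
    {w : Fin (n + 2) → ℝ} (hρ : 0 < (Fin.init w : Fin (n + 1) → ℝ) (Fin.last n))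
    (hw : (Fin.snoc (Fin.init w : Fin (n + 1) → ℝ) 0 : Fin (n + 2) → ℝ) ∈ σ) :
    Φ w ∈ {x ∈ σ | x (Fin.last (n + 1)) ≠ 0 ∨ 0 < (Fin.init x : Fin (n + 1) → ℝ) (Fin.last n)} := by
  refine ⟨(chart_mem_and_eq hinv hΦ hw).1, ?_⟩
  rw [hΦ]
  simp only [init_snoc_snoc_last, snoc_snoc_last]
  by_cases hu : w (Fin.last (n + 1)) = 0
  · right
    rw [hu]
    simpa using hρ
  · left
    refine mul_ne_zero (div_ne_zero (mul_ne_zero two_ne_zero hu) (by positivity)) hρ.ne'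

/-- The chart is injective on `ρ > 0`. [folklore] -/
theorem chart_injOn
    (hΦ : ∀ w, Φ w = Fin.snoc (Fin.snoc (Fin.init (Fin.init w : Fin (n + 1) → ℝ) : Fin n → ℝ)
        ((1 - w (Fin.last (n + 1)) ^ 2) / (1 + w (Fin.last (n + 1)) ^ 2) *
          (Fin.init w : Fin (n + 1) → ℝ) (Fin.last n)) : Fin (n + 1) → ℝ)
        (2 * w (Fin.last (n + 1)) / (1 + w (Fin.last (n + 1)) ^ 2) *
          (Fin.init w : Fin (n + 1) → ℝ) (Fin.last n))) :
    InjOn Φ {w : Fin (n + 2) → ℝ | 0 < (Fin.init w : Fin (n + 1) → ℝ) (Fin.last n)} := by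
  intro w hw w' hw' h
  rw [hΦ, hΦ] at h
  obtain ⟨hv, hc, hs⟩ := snoc_snoc_inj h
  have hw0 : 0 < (Fin.init w : Fin (n + 1) → ℝ) (Fin.last n) := hw
  have hw0' : 0 < (Fin.init w' : Fin (n + 1) → ℝ) (Fin.last n) := hw'
  set ρ := (Fin.init w : Fin (n + 1) → ℝ) (Fin.last n) with hρdef
  set ρ' := (Fin.init w' : Fin (n + 1) → ℝ) (Fin.last n) with hρ'def
  set u := w (Fin.last (n + 1)) with hudef
  set u' := w' (Fin.last (n + 1)) with hu'def
  have hρ : ρ ^ 2 = ρ' ^ 2 := by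
    have e1 := ratCircle_sq_add_sq u
    have e2 := ratCircle_sq_add_sq u'
    have h1 : ρ ^ 2 = ((1 - u ^ 2) / (1 + u ^ 2) * ρ) ^ 2 + (2 * u / (1 + u ^ 2) * ρ) ^ 2 := by
      linear_combination (-(ρ ^ 2)) * e1
    have h2 : ρ' ^ 2 = ((1 - u' ^ 2) / (1 + u' ^ 2) * ρ') ^ 2 + (2 * u' / (1 + u' ^ 2) * ρ') ^ 2 := by
      linear_combination (-(ρ' ^ 2)) * e2
    rw [h1, h2, hc, hs]
  have hρρ : ρ = ρ' := (pow_left_inj₀ hw0.le hw0'.le two_ne_zero).1 hρ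
  rw [hρρ] at hc hs
  have hc' := mul_right_cancel₀ hw0'.ne' hc
  have hs' := mul_right_cancel₀ hw0'.ne' hs
  have hu : u = u' := halfAngle_inj hc' hs'
  rw [← snoc_snoc_init w, ← snoc_snoc_init w']
  simp only [← hρdef, ← hρ'def, ← hudef, ← hu'def, hv, hρρ, hu]

/-- The chart maps the reduced domain ONTO `E`: every point off the non-positive axis has a half-angle,
and its axis point lies in `σ` by invariance (rotate back by the point's own angle). [folklore] -/
theorem image_chart
    (hinv : ∀ x ∈ σ, ∀ c s : ℝ, c ^ 2 + s ^ 2 = 1 →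
      (Fin.snoc (Fin.snoc (Fin.init (Fin.init x : Fin (n + 1) → ℝ) : Fin n → ℝ)
          (c * (Fin.init x : Fin (n + 1) → ℝ) (Fin.last n) - s * x (Fin.last (n + 1))) :
            Fin (n + 1) → ℝ)
          (s * (Fin.init x : Fin (n + 1) → ℝ) (Fin.last n) + c * x (Fin.last (n + 1))) :
          Fin (n + 2) → ℝ) ∈ σ ∧
      f (Fin.snoc (Fin.snoc (Fin.init (Fin.init x : Fin (n + 1) → ℝ) : Fin n → ℝ)
          (c * (Fin.init x : Fin (n + 1) → ℝ) (Fin.last n) - s * x (Fin.last (n + 1))) :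
            Fin (n + 1) → ℝ)
          (s * (Fin.init x : Fin (n + 1) → ℝ) (Fin.last n) + c * x (Fin.last (n + 1))) :
          Fin (n + 2) → ℝ) = f x)
    (hΦ : ∀ w, Φ w = Fin.snoc (Fin.snoc (Fin.init (Fin.init w : Fin (n + 1) → ℝ) : Fin n → ℝ)
        ((1 - w (Fin.last (n + 1)) ^ 2) / (1 + w (Fin.last (n + 1)) ^ 2) *
          (Fin.init w : Fin (n + 1) → ℝ) (Fin.last n)) : Fin (n + 1) → ℝ)
        (2 * w (Fin.last (n + 1)) / (1 + w (Fin.last (n + 1)) ^ 2) *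
          (Fin.init w : Fin (n + 1) → ℝ) (Fin.last n))) :
    Φ '' {w : Fin (n + 2) → ℝ | 0 < (Fin.init w : Fin (n + 1) → ℝ) (Fin.last n) ∧
        (Fin.snoc (Fin.init w : Fin (n + 1) → ℝ) 0 : Fin (n + 2) → ℝ) ∈ σ} =
      {x ∈ σ | x (Fin.last (n + 1)) ≠ 0 ∨ 0 < (Fin.init x : Fin (n + 1) → ℝ) (Fin.last n)} := by
  ext x
  constructor
  · rintro ⟨w, ⟨hρ, hw⟩, rfl⟩
    exact chart_mem_excised hinv hΦ hρ hw
  · rintro ⟨hx, hax⟩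
    set y := (Fin.init x : Fin (n + 1) → ℝ) (Fin.last n) with hydef
    set z := x (Fin.last (n + 1)) with hzdef
    set v := (Fin.init (Fin.init x : Fin (n + 1) → ℝ) : Fin n → ℝ) with hvdef
    obtain ⟨hρ, hc, hs⟩ := halfAngle_surj hax
    set ρ := Real.sqrt (y ^ 2 + z ^ 2) with hρdef
    set u := z / (ρ + y) with hudef
    have hρ2 : ρ ^ 2 = y ^ 2 + z ^ 2 := by rw [hρdef, Real.sq_sqrt (by positivity)]
    -- the axis point `(v, ρ, 0)` lies in `σ`: rotate `x` back by its own angle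
    have hax' : (Fin.snoc (Fin.snoc v ρ : Fin (n + 1) → ℝ) 0 : Fin (n + 2) → ℝ) ∈ σ := by
      have h := (hinv x hx (y / ρ) (-(z / ρ)) (by
        field_simp
        linarith [hρ2])).1
      have e1 : y / ρ * y - -(z / ρ) * z = ρ := by
        field_simp
        linarith [hρ2]
      have e2 : -(z / ρ) * y + y / ρ * z = 0 := by ring
      simp only [← hydef, ← hzdef, ← hvdef, e1, e2] at h
      exact h
    refine ⟨Fin.snoc (Fin.snoc v ρ : Fin (n + 1) → ℝ) u, ⟨by simpa using hρ, ?_⟩, ?_⟩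
    · simpa using hax'
    · rw [hΦ]
      simp only [init_init_snoc_snoc, init_snoc_snoc_last, snoc_snoc_last]
      rw [hc, hs, hydef, hzdef, hvdef, snoc_snoc_init]

/-- The chart is a `ℚ`-semialgebraic map on any `ℚ`-semialgebraic set: its components are rational
functions of the coordinates with the non-vanishing denominator `1 + u²`. [cite: BCR1998, §2.2] -/
theorem isSemialgebraicMapOn_chart
    (hΦ : ∀ w, Φ w = Fin.snoc (Fin.snoc (Fin.init (Fin.init w : Fin (n + 1) → ℝ) : Fin n → ℝ)
        ((1 - w (Fin.last (n + 1)) ^ 2) / (1 + w (Fin.last (n + 1)) ^ 2) *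
          (Fin.init w : Fin (n + 1) → ℝ) (Fin.last n)) : Fin (n + 1) → ℝ)
        (2 * w (Fin.last (n + 1)) / (1 + w (Fin.last (n + 1)) ^ 2) *
          (Fin.init w : Fin (n + 1) → ℝ) (Fin.last n)))
    {D : Set (Fin (n + 2) → ℝ)} (hD : IsSemialgebraic ℚ D) : IsSemialgebraicMapOn ℚ D Φ := by
  refine IsSemialgebraicMapOn.of_forall hD fun j => ?_
  refine Fin.lastCases ?_ (fun j => ?_) j
  · -- last coordinate: `sin(u) ρ = 2 u ρ / (1 + u²)`
    refine (isSemialgebraicFunOn_aeval_div_aeval hD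
      (2 * MvPolynomial.X (Fin.last (n + 1)) * MvPolynomial.X (Fin.castSucc (Fin.last n)))
      (1 + MvPolynomial.X (Fin.last (n + 1)) ^ 2) fun w _ => ?_).congr fun w _ => ?_
    · simp only [map_add, map_one, map_pow, MvPolynomial.aeval_X]
      positivity
    · rw [hΦ]
      simp [Fin.init]
      ring
  · refine Fin.lastCases ?_ (fun j => ?_) j
    · -- coordinate `n`: `cos(u) ρ = (1 − u²) ρ / (1 + u²)`
      refine (isSemialgebraicFunOn_aeval_div_aeval hD
        ((1 - MvPolynomial.X (Fin.last (n + 1)) ^ 2) * MvPolynomial.X (Fin.castSucc (Fin.last n)))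
        (1 + MvPolynomial.X (Fin.last (n + 1)) ^ 2) fun w _ => ?_).congr fun w _ => ?_
      · simp only [map_add, map_one, map_pow, MvPolynomial.aeval_X]
        positivity
      · rw [hΦ]
        simp [Fin.init]
        ring
    · -- spectator coordinates
      refine (isSemialgebraicFunOn_apply hD (Fin.castSucc (Fin.castSucc j))).congr fun w _ => ?_
      rw [hΦ]
      simp [Fin.init]

end Chart

/-! ## The engine -/

/-- **THE ROTATION ENGINE** (stub 44 of the line `Sketch` of crux `TateLifting`). Let `r = [σ, f]` be a
representation of dimension `n + 2` whose domain and integrand are invariant under the rotations of the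
last two coordinates `(y, z)`. Then the honest reduced representation
`q = [{(v, ρ, u) | ρ > 0, (v, ρ, 0) ∈ σ}, 2ρ/(1+u²)·f(v, ρ, 0)]` exists and `[σ, f] − [q] ∈ KZ.relations`:
rule (1a) excises the null half-hyperplane `{z = 0, y ≤ 0}`, rule (2) is ONE change of variables along
the tan-half-angle chart `Φ(v, ρ, u) = (v, ρ(1−u²)/(1+u²), 2ρu/(1+u²))` (Jacobian `2ρ/(1+u²)`), and
`f ∘ Φ = f(v, ρ, 0)` on the reduced domain by invariance. [cite: KontsevichZagier2001, §1.2 rule (2)] -/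
theorem _root_.Summit.KontsevichZagierPeriods.InverseLandau.tateLifting_rotationEngine :
    ∀ (n : ℕ) (r : KZ.IntegralRep (n + 2)),
      (∀ x ∈ r.domain, ∀ c s : ℝ, c ^ 2 + s ^ 2 = 1 →
        (Fin.snoc (Fin.snoc (Fin.init (Fin.init x : Fin (n + 1) → ℝ) : Fin n → ℝ)
            (c * (Fin.init x : Fin (n + 1) → ℝ) (Fin.last n) - s * x (Fin.last (n + 1))) :
              Fin (n + 1) → ℝ)
            (s * (Fin.init x : Fin (n + 1) → ℝ) (Fin.last n) + c * x (Fin.last (n + 1))) :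
            Fin (n + 2) → ℝ) ∈ r.domain ∧
        r.integrand (Fin.snoc (Fin.snoc (Fin.init (Fin.init x : Fin (n + 1) → ℝ) : Fin n → ℝ)
            (c * (Fin.init x : Fin (n + 1) → ℝ) (Fin.last n) - s * x (Fin.last (n + 1))) :
              Fin (n + 1) → ℝ)
            (s * (Fin.init x : Fin (n + 1) → ℝ) (Fin.last n) + c * x (Fin.last (n + 1))) :
            Fin (n + 2) → ℝ) = r.integrand x) →
      ∃ q : KZ.IntegralRep (n + 2),
        q.domain = {w | 0 < (Fin.init w : Fin (n + 1) → ℝ) (Fin.last n) ∧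
          (Fin.snoc (Fin.init w : Fin (n + 1) → ℝ) 0 : Fin (n + 2) → ℝ) ∈ r.domain} ∧
        (q.integrand = fun w => 2 * (Fin.init w : Fin (n + 1) → ℝ) (Fin.last n) /
            (1 + w (Fin.last (n + 1)) ^ 2) *
          r.integrand (Fin.snoc (Fin.init w : Fin (n + 1) → ℝ) 0 : Fin (n + 2) → ℝ)) ∧
        KZ.of r - KZ.of q ∈ KZ.relations := by
  intro n r hinv
  obtain ⟨Φ, Φ', hΦ, hΦd, hΦdet⟩ := exists_rotationChart n
  -- the reduced domain `D`
  set D : Set (Fin (n + 2) → ℝ) := {w | 0 < (Fin.init w : Fin (n + 1) → ℝ) (Fin.last n) ∧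
    (Fin.snoc (Fin.init w : Fin (n + 1) → ℝ) 0 : Fin (n + 2) → ℝ) ∈ r.domain} with hD_def
  have hD : IsSemialgebraic ℚ D := isSemialgebraic_reducedDomain r.isSemialgebraic_domain
  -- rule (1a): excise the null half-hyperplane
  set E : Set (Fin (n + 2) → ℝ) :=
    {x ∈ r.domain | x (Fin.last (n + 1)) ≠ 0 ∨ 0 < (Fin.init x : Fin (n + 1) → ℝ) (Fin.last n)} with hE_def
  have hE : IsSemialgebraic ℚ E := isSemialgebraic_excised r.isSemialgebraic_domain
  have hEσ : E ⊆ r.domain := fun x hx => hx.1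
  have h1 : KZ.of r - KZ.of (r.restrict E hE hEσ) ∈ KZ.relations :=
    KZ.IntegralRep.of_sub_of_restrict_mem_relations r hE hEσ (volume_diff_excised r.domain)
  -- rule (2): the honest pull-back of `r|E` along the chart
  have hJsa : IsSemialgebraicFunOn ℚ D (fun w => 2 * (Fin.init w : Fin (n + 1) → ℝ) (Fin.last n) /
      (1 + w (Fin.last (n + 1)) ^ 2)) := by
    refine (isSemialgebraicFunOn_aeval_div_aeval hD
      (2 * MvPolynomial.X (Fin.castSucc (Fin.last n))) (1 + MvPolynomial.X (Fin.last (n + 1)) ^ 2)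
      fun w _ => ?_).congr fun w _ => ?_
    · simp only [map_add, map_one, map_pow, MvPolynomial.aeval_X]
      positivity
    · simp [Fin.init]
  have hJdet : ∀ w ∈ D, 2 * (Fin.init w : Fin (n + 1) → ℝ) (Fin.last n) / (1 + w (Fin.last (n + 1)) ^ 2) =
      |(Φ' w).det| := by
    intro w hw
    rw [hΦdet, abs_of_pos (div_pos (by linarith [hw.1]) (by positivity))]
  have hinj : InjOn Φ D := (chart_injOn hΦ).mono fun w hw => hw.1
  have himage : Φ '' D = (r.restrict E hE hEσ).domain := by
    rw [KZ.IntegralRep.domain_restrict]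
    exact image_chart hinv hΦ
  obtain ⟨q₀, hq₀d, hq₀i, hq₀rel⟩ := tateLifting_pullback (n + 2) (r.restrict E hE hEσ) D Φ Φ'
    (fun w => 2 * (Fin.init w : Fin (n + 1) → ℝ) (Fin.last n) / (1 + w (Fin.last (n + 1)) ^ 2)) hD
    (isSemialgebraicMapOn_chart hΦ hD) (fun w _ => (hΦd w).hasFDerivWithinAt) hinj himage hJsa hJdet
  -- the reduced representation with the AXIS integrand (invariance: `f ∘ Φ = f(v, ρ, 0)` on `D`)
  set g : (Fin (n + 2) → ℝ) → ℝ := fun w => 2 * (Fin.init w : Fin (n + 1) → ℝ) (Fin.last n) /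
      (1 + w (Fin.last (n + 1)) ^ 2) *
    r.integrand (Fin.snoc (Fin.init w : Fin (n + 1) → ℝ) 0 : Fin (n + 2) → ℝ) with hg_def
  have hg_eq : EqOn q₀.integrand g D := by
    intro w hw
    rw [hq₀i, hg_def]
    simp only [KZ.IntegralRep.integrand_restrict, (chart_mem_and_eq hinv hΦ hw.2).2]
  have hgsa : IsSemialgebraicFunOn ℚ D g := by
    have h := q₀.isSemialgebraicFunOn_integrand
    rw [hq₀d] at h
    exact h.congr hg_eq
  have hgint : IntegrableOn g D :=
    (hq₀d ▸ q₀.integrableOn).congr_fun hg_eq (IsSemialgebraic.measurableSet_holds hD)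
  let q : KZ.IntegralRep (n + 2) := ⟨D, g, hD, hgsa, hgint⟩
  have h3 : KZ.of q₀ - KZ.of q ∈ KZ.relations :=
    KZ.of_sub_of_mem_relations_of_eqOn (by rw [hq₀d]) (by rw [hq₀d]; exact hg_eq)
  refine ⟨q, rfl, rfl, ?_⟩
  have : KZ.of r - KZ.of q =
      (KZ.of r - KZ.of (r.restrict E hE hEσ)) + (KZ.of (r.restrict E hE hEσ) - KZ.of q₀) +
        (KZ.of q₀ - KZ.of q) := by abel
  rw [this]
  exact KZ.relations.add_mem (KZ.relations.add_mem h1 hq₀rel) h3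

end RotationEngine

end Summit.KontsevichZagierPeriods.InverseLandau
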